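import Summits.QuantumFields.BalabanUV.T4Continuum.Support.OutputRateWindow
import Literature.MathematicalPhysics.QuantumFieldTheory.Balaban1983to89.T4OutputRateWitness

/-!
# OutputRateWindow, bounded reassembly — WHEN do per-singleton `NE5` faces reassemble to `NE5` on a window `W`?
# (cell `pub-balaban`, T⁴ fan-out, `HOME/BINDER-OWNERS.md` row NE5, owner lineage t4-ne5-p1, gen 31; owner ruling R29 answering the
# NE5 referee's INFO-27, `t4/formal/NE5/REFEREE.md` pass 11)

HONEST FRAMING (T4-DAG PAGE 1).  Rung (B)+1 on ONE finite four-torus of fixed physical size — NOT infinite volume, NOT a mass gap, NOT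
the Clay problem; `FlowStep.BetaPertH`, (B), (B^μ) do not occur here.  NE5 (`T4OutputRate.NE5`) is NOT PRINTED ([Balaban1987RG1]–
[Balaban1989LargeFieldII] print ε-UNIFORM bounds, never η-RATES; cell GAPS G-t4-U3-1) and NOT PROVED (spine 0/9).  Nothing of Bałaban's
series is asserted; 0 cite tags.  HONEST DEPENDENCY (cell, verbatim): continuum YM on T⁴ ⇐ BetaPertH ∧ nine spine estimates (0/9 proved);
BetaPertH ⇐ (D1) ∧ (D4) ∧ CAP+tail; G-an2-4 gates asym, D1 and NE2/3/4.

WHY.  Ruling R24 (`OutputRateWindow`) instantiates the `g`-free dictionaries of the model of record per SINGLETON window `{g}` and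
reassembles with `ne5_of_forall_singleton`, which needs ONE constant `C₅` for every `g ∈ W`.  The referee's INFO-27: an END face that
concludes `∃ C₅, NE5 EA EB {g} κ θ C₅` per singleton is NOT `NE5` on `W`.  This module makes the exact boundary a kernel fact:
* `ne5_mono_const` — `NE5` is monotone in the constant (for `0 ≤ θ`);
* `ne5_of_forall_singleton_le` ∕ `ne5_of_forall_singleton_bddAbove` — per-singleton constants `Cg g` that are BOUNDED ON `W` reassemble
  (with any common upper bound, resp. with `sSup (Cg '' W)`);
* `exists_ne5_iff_forall_singleton_bddAbove` — `∃ C₅, NE5 … W …` ⟺ there is a per-singleton constant family bounded on `W`;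
* NEGATIVE CONTROL `grow_forall_singleton_exists` ∧ `grow_not_exists_uniform` — on the toy carriers of `T4OutputRateWitness` the
  pair `(g ↦ g 0, 0)` obeys `NE5 … {g} … |g 0|` for EVERY `g`, yet NO constant serves the window `univ`: per-singleton `∃ C₅` faces do
  not reassemble in general.
CONSEQUENCE FOR INSTANCERS (R29).  Reassemble only END faces whose constant is an EXPLICIT expression in `g`-free letters (all owner END
faces display `C₅` as a closed formula in the letters `G, ρ₀, δ, δ′, B, ω, c, θ′`; if the letters are `g`-uniform on `W` the formula is the
common bound), or exhibit `BddAbove` of the per-`g` constants; a face of the shape `… → ∃ C₅, NE5 EA EB W κ θ C₅` with the window (or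
the run pair, or g-indexed letters) bound BEFORE the existential is TERMINAL for its own window unless that bound is displayed
(`exists_ne5_iff_forall_singleton_bddAbove`).  [v1.1 erratum, ruling R29′: faces with `∃ C₅` OUTERMOST — before carriers, slots and
window are bound, e.g. `B13StepEndArithmetic.uniform_ne5_of_record[_insOp]`, `B13StepSecantArithmetic.uniform_ne5_of_record_secant` —
carry ONE constant for every window and reassemble at no cost (finding of the N69∕N80 lineage, journal l.12288); v1 listed them
among the terminal faces by mistake.]

Bookkeeping/[folklore]; no estimate; 0 sorry; axioms ⊆ {propext, Classical.choice, Quot.sound}.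
-/

namespace Summit.QuantumFields.BalabanUV.T4Continuum.OutputRateWindowBounded

open Set
open Literature.MathematicalPhysics.QuantumFieldTheory.Balaban1983to89.T4OutputRate
open Summit.QuantumFields.BalabanUV.T4Continuum.OutputRateWindow

section Reassembly

variable {C : Carriers} {EA : Functional C C.BgA} {EB : Functional C C.BgB} {W : Set (ℕ → ℝ)} {κ θ C₅ C₅' : ℝ}

/-- `NE5` is MONOTONE in its constant when the rate is nonnegative. [folklore] -/
theorem ne5_mono_const (h : NE5 EA EB W κ θ C₅) (hC : C₅ ≤ C₅') (hθ : 0 ≤ θ) : NE5 EA EB W κ θ C₅' :=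
  fun g hg U X => (h g hg U X).trans
    (mul_le_mul_of_nonneg_right (mul_le_mul_of_nonneg_right hC (pow_nonneg hθ _)) (Real.exp_pos _).le)

/-- **Bounded reassembly.**  Per-singleton `NE5` faces with constants `Cg g` dominated by ONE `C₅` on the window reassemble to `NE5` on
the window with that `C₅`. [folklore] -/
theorem ne5_of_forall_singleton_le {Cg : (ℕ → ℝ) → ℝ} (h : ∀ g ∈ W, NE5 EA EB {g} κ θ (Cg g))
    (hle : ∀ g ∈ W, Cg g ≤ C₅) (hθ : 0 ≤ θ) : NE5 EA EB W κ θ C₅ :=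
  ne5_of_forall_singleton fun g hg => ne5_mono_const (h g hg) (hle g hg) hθ

/-- The same with the least common bound: if the per-singleton constants are bounded above on `W`, `NE5` holds on `W` with
`sSup (Cg '' W)`. [folklore] -/
theorem ne5_of_forall_singleton_bddAbove {Cg : (ℕ → ℝ) → ℝ} (h : ∀ g ∈ W, NE5 EA EB {g} κ θ (Cg g))
    (hb : BddAbove (Cg '' W)) (hθ : 0 ≤ θ) : NE5 EA EB W κ θ (sSup (Cg '' W)) :=
  ne5_of_forall_singleton_le h (fun _ hg => le_csSup hb (mem_image_of_mem Cg hg)) hθ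

/-- **The exact boundary (INFO-27 settled).**  `NE5` holds on `W` with SOME constant iff there is a family of per-singleton constants
that is BOUNDED on `W`. [folklore] -/
theorem exists_ne5_iff_forall_singleton_bddAbove (hθ : 0 ≤ θ) :
    (∃ C₅, NE5 EA EB W κ θ C₅) ↔
      ∃ Cg : (ℕ → ℝ) → ℝ, BddAbove (Cg '' W) ∧ ∀ g ∈ W, NE5 EA EB {g} κ θ (Cg g) := by
  constructor
  · rintro ⟨C₅, h⟩
    refine ⟨fun _ => C₅, ⟨C₅, ?_⟩, fun _ hg => ne5_antitone_window h (singleton_subset_iff.2 hg)⟩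
    rintro _ ⟨_, -, rfl⟩
    exact le_rfl
  · rintro ⟨Cg, hb, h⟩
    exact ⟨_, ne5_of_forall_singleton_bddAbove h hb hθ⟩

/-- Per-singleton `∃ C₅` faces with a UNIFORM witness bound reassemble (the usable form of an `∃` END: exhibit the bound). [folklore] -/
theorem ne5_of_forall_singleton_exists_le (h : ∀ g ∈ W, ∃ C, C ≤ C₅ ∧ NE5 EA EB {g} κ θ C) (hθ : 0 ≤ θ) :
    NE5 EA EB W κ θ C₅ :=
  ne5_of_forall_singleton fun g hg => by
    obtain ⟨C, hC, hN⟩ := h g hg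
    exact ne5_mono_const hN hC hθ

end Reassembly

/-! ## Negative control: per-singleton `∃ C₅` does NOT reassemble in general -/

section NegativeControl

open Literature.MathematicalPhysics.QuantumFieldTheory.Balaban1983to89.T4OutputRateWitness (toyC)

/-- NEGATIVE CONTROL on the witness carriers `toyC` (domains = steps, `d ≡ 0`, backgrounds real, transport `id`), with the toy
pair «run A reads the first coupling, `EA g U X := g 0`; run B outputs `0`»: on every SINGLETON window the pair obeys `NE5` at rate `1`,
`κ = 0`, with the `g`-dependent constant `|g 0|`. [folklore] -/
theorem grow_singleton (g : ℕ → ℝ) :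
    NE5 (C := toyC) (fun g' _ _ => g' 0) (fun _ _ _ => 0) {g} 0 1 |g 0| := by
  intro g' hg' U X
  rw [mem_singleton_iff] at hg'
  subst hg'
  simp

/-- Hence every singleton window carries SOME constant. [folklore] -/
theorem grow_forall_singleton_exists :
    ∀ g ∈ (univ : Set (ℕ → ℝ)), ∃ C₅, NE5 (C := toyC) (fun g' _ _ => g' 0) (fun _ _ _ => 0) {g} 0 1 C₅ :=
  fun g _ => ⟨|g 0|, grow_singleton g⟩

/-- … but NO constant serves the whole window (test `g ≡ C₅ + 1`).  So an END face of the form `∃ C₅, NE5 … {g} …` is terminal for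
its window and is not an input to `ne5_of_forall_singleton` (ruling R29). [folklore] -/
theorem grow_not_exists_uniform :
    ¬ ∃ C₅, NE5 (C := toyC) (fun g' _ _ => g' 0) (fun _ _ _ => 0) (univ : Set (ℕ → ℝ)) 0 1 C₅ := by
  rintro ⟨C₅, h⟩
  have h1 := h (fun _ => C₅ + 1) (mem_univ _) (0 : ℝ) (0 : ℕ)
  simp only [sub_zero, one_pow, mul_one, zero_mul, neg_zero, Real.exp_zero] at h1
  linarith [le_abs_self (C₅ + 1)]

/-- The per-singleton constant family of the toy is `g ↦ |g 0|`, NOT bounded on `univ` — consistent with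
`exists_ne5_iff_forall_singleton_bddAbove`. [folklore] -/
theorem grow_constants_not_bddAbove : ¬ BddAbove ((fun g : ℕ → ℝ => |g 0|) '' (univ : Set (ℕ → ℝ))) := by
  rintro ⟨B, hB⟩
  have h1 : |(fun _ : ℕ => B + 1) 0| ≤ B :=
    hB (mem_image_of_mem (fun g : ℕ → ℝ => |g 0|) (mem_univ (fun _ : ℕ => B + 1)))
  linarith [le_abs_self (B + 1)]

end NegativeControl

end Summit.QuantumFields.BalabanUV.T4Continuum.OutputRateWindowBounded
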